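import Mathlib.Combinatorics.SimpleGraph.Paths
import Mathlib.Combinatorics.SimpleGraph.Connectivity.Connected
import HarnessLib

/-!
# Two-colouring a graph with exactly two bichromatic edges: helper for `DiscretisationFamilyExists` (stmt-CriticalPhenomena-9644)

Pure graph theory behind the admissibility fields `disjoint`, `zdBoundary_subset`,
`ncard_zdABEdges_eq_two` of `IsZdAdmissible` in the construction of a discretisation family: the
discrete arcs are the two classes of a colouring of the graph `H` of `Ω_δ`-edges between boundary
sites, which must have EXACTLY two bichromatic edges `e_a = s(u_a, v_a)`, `e_b = s(u_b, v_b)` (the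
`A`–`B` edges at the two marked points).

* `reachable_deleteEdges_colouring`: if every cycle of `H` through `e_a` passes through `e_b` and
  conversely, and in `H ∖ {e_a, e_b}` the vertex `v_b` is joined to `u_a` (in the application:
  along the outer boundary cycle), then colouring by reachability from `u_a` in
  `H' = H ∖ {e_a, e_b}` puts `u_a, v_b` in one class and `v_a, u_b` in the other, and every edge of
  `H` leaving the class of `u_a` is `e_a` or `e_b`.

Mathlib anchors: `SimpleGraph.deleteEdges`, `SimpleGraph.Reachable`, `SimpleGraph.Walk.IsCycle`,
`SimpleGraph.Walk.cons_isCycle_iff`, `SimpleGraph.Walk.mapLe`.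
-/

namespace Summit.CriticalPhenomena.CardyFormulaZ2.Theorems.DiscretisationFamilyExists

open SimpleGraph

variable {V : Type*}

/-- **A cycle through a deleted edge.** If `u, v` are adjacent in `H` and `v` is joined to `u` in
`H ∖ s`, where `s(u, v) ∈ s`, then `H` has a cycle through `s(u, v)` all of whose other edges
avoid `s` (a path of `H ∖ s` from `v` to `u` closed up by the edge). [folklore] -/
theorem exists_isCycle_of_reachable_deleteEdges (H : SimpleGraph V) (s : Set (Sym2 V)) {u v : V}
    (hadj : H.Adj u v) (huv : s(u, v) ∈ s) (hr : (H.deleteEdges s).Reachable v u) :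
    ∃ c : H.Walk u u, c.IsCycle ∧ s(u, v) ∈ c.edges ∧ ∀ e ∈ c.edges, e ∈ s → e = s(u, v) := by
  classical
  obtain ⟨p⟩ := hr
  set q : (H.deleteEdges s).Walk v u := p.toPath.1 with hq
  have hqpath : q.IsPath := p.toPath.2
  set q' : H.Walk v u := Walk.mapLe (H.deleteEdges_le s) q with hq'
  have hq'path : q'.IsPath := (Walk.isPath_mapLe _).2 hqpath
  have hq'edges : ∀ e ∈ q'.edges, e ∉ s := by
    intro e he hes
    rw [hq', Walk.edges_mapLe_eq_edges] at he
    have := Walk.edges_subset_edgeSet _ he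
    rw [edgeSet_deleteEdges] at this
    exact this.2 hes
  refine ⟨Walk.cons hadj q', (Walk.cons_isCycle_iff q' hadj).2 ⟨hq'path, fun h => hq'edges _ h huv⟩,
    by simp, fun e he hes => ?_⟩
  rw [Walk.edges_cons, List.mem_cons] at he
  rcases he with rfl | he
  · rfl
  · exact absurd hes (hq'edges e he)

/-- **Reachability colouring with exactly two bichromatic edges.** Let `e_a = s(u_a, v_a)` and
`e_b = s(u_b, v_b)` be two distinct edges of `H` such that every cycle through one of them passes
through the other, and such that in `H' = H ∖ {e_a, e_b}` the vertex `v_b` is joined to `u_a`.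
Then in `H'`: `u_a` is not joined to `v_a`, nor to `u_b`, but is joined to `v_b`;
and every edge of `H` from a vertex joined to `u_a` to a vertex not joined to `u_a` is `e_a` or
`e_b`.  (So the classes "joined to `u_a` in `H'`" / "not joined" have exactly the two bichromatic
edges `e_a`, `e_b`.) [folklore] -/
theorem reachable_deleteEdges_colouring (H : SimpleGraph V) {ua va ub vb : V}
    (hab : s(ua, va) ≠ s(ub, vb)) (hadja : H.Adj ua va) (hadjb : H.Adj ub vb)
    (h5a : ∀ (x : V) (c : H.Walk x x), c.IsCycle → s(ua, va) ∈ c.edges → s(ub, vb) ∈ c.edges)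
    (h5b : ∀ (x : V) (c : H.Walk x x), c.IsCycle → s(ub, vb) ∈ c.edges → s(ua, va) ∈ c.edges)
    (hwb : (H.deleteEdges {s(ua, va), s(ub, vb)}).Reachable vb ua) :
    ¬ (H.deleteEdges {s(ua, va), s(ub, vb)}).Reachable ua va ∧
    ¬ (H.deleteEdges {s(ua, va), s(ub, vb)}).Reachable ua ub ∧
    (H.deleteEdges {s(ua, va), s(ub, vb)}).Reachable ua vb ∧
    ∀ x y, H.Adj x y → (H.deleteEdges {s(ua, va), s(ub, vb)}).Reachable ua x →
      ¬ (H.deleteEdges {s(ua, va), s(ub, vb)}).Reachable ua y →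
      s(x, y) = s(ua, va) ∨ s(x, y) = s(ub, vb) := by
  set s : Set (Sym2 V) := {s(ua, va), s(ub, vb)} with hs
  have ha : s(ua, va) ∈ s := Set.mem_insert _ _
  have hb : s(ub, vb) ∈ s := Set.mem_insert_of_mem _ rfl
  -- no cycle through exactly one of the two edges
  have nca : ¬ (H.deleteEdges s).Reachable va ua := fun hr => by
    obtain ⟨c, hc, hca, hcs⟩ := exists_isCycle_of_reachable_deleteEdges H s hadja ha hr
    exact hab (hcs _ (h5a _ c hc hca) hb).symm
  have ncb : ¬ (H.deleteEdges s).Reachable vb ub := fun hr => by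
    obtain ⟨c, hc, hcb, hcs⟩ := exists_isCycle_of_reachable_deleteEdges H s hadjb hb hr
    exact hab (hcs _ (h5b _ c hc hcb) ha)
  refine ⟨fun h => nca h.symm, fun h => ncb (hwb.trans h), hwb.symm, fun x y hxy hx hy => ?_⟩
  by_contra hne
  push Not at hne
  refine hy (hx.trans (Adj.reachable ?_))
  rw [deleteEdges_adj]
  refine ⟨hxy, ?_⟩
  rintro (h | h)
  · exact hne.1 h
  · exact hne.2 h

end Summit.CriticalPhenomena.CardyFormulaZ2.Theorems.DiscretisationFamilyExists
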